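import Summits.HodgeConjecture.HodgeConjecture.Theorems.Ring2AbelianAllEllipticPowerCarriersDefs
import Literature.AlgebraicGeometry.HodgeTheory.WeilClassesMoonenZarhinCriterion
import HarnessLib

/-!
# Ring 2 / AbelianAll (André column) — the node «CARRIERS FOR E-WEIL CLASSES AT E-TENSOR POINTS OVER ONE ELLIPTIC CURVE» (definitions only)

research route, not a corollary; conditional on HC_CM plus one named minimal statement.

DEFINITIONS ONLY (nothing asserted, nothing proved; `HC_CM` absent). PART AB (gen 59) named `EllipticPowerAlgebraicCarriers 𝒪`: carriers for
ALL rational algebraic classes on EVERY abelian variety isogenous to a power of ANY elliptic curve. André's Lemme 6.3.3 needs far less at its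
special fibre (proof, p. 33: `V := V₀ ⊗ E`, `V₀ = H¹(E₀^p)` with `E₀` of OUR choice — «par exemple»; the extended class `ξ̃` lies in the line
`⋀^{2p}_E V`, pointwise fixed by `G = Res SU(V, φ)`): a carrier for an `E`-WEIL CLASS of the tensor structure, on powers of ONE prescribed
elliptic curve. The Literature named fact `Andre1996.andre1996_cmHodgeClasses_weilTensorPencils` (this generation; statement only) records exactly
that. This file names the matching carrier node in the road's vocabulary (PART AA-a `AnchoredCarrierAt`):

* `ellipticPowerPolarisedAnchorOf E₀ n` (anchor predicate, reducible): PART AB-e's `ellipticPowerPolarisedAnchor n` with the elliptic curve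
  FIXED to `E₀` — `X ≅ A₀`, `dim A₀ = n`, `A₀` isogenous to `E₀^{N+1}`, `θ` a polarisation class.
* `weilStructureServedClasses n p` (served-class map, reducible): the classes `w ∈ H^{2p}(X(ℂ); ℂ)` of Hodge type `(p,p)` that are `E`-WEIL
  CLASSES of SOME CM-field structure on `X`: `e^*w ∈ weilClassesOf A₀ ψ₀ p δ` for `e : A₀.X ≅ X`, `ψ₀ ≫ ψ₀ = -δ`, `δ ≥ 1`, `n = 2p` (imaginary
  quadratic `E`), or `e^*w ∈ weilClassesField A₀ ψ₀ P (2p)` for a CM-field presentation `(ψ₀, P)` of degree `e > 2`, `n = p·e` (binders verbatim those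
  of `Andre1992_hodgeClasses_cmAbelianVariety_mem_span_pullback_weilClasses` and of the new fact) — per structure a space of dimension `[E:ℚ]`
  (van Geemen Lemma 5.2 (5); Moonen–Zarhin §1), inside the Lefschetz classes of the elliptic power.
* `EllipticTensorWeilCarriers 𝒪 E₀` (`@[conjecture]`, door-generic): for all `n`, `p` with `2 ≤ p ≤ n − 2`,
  `AnchoredCarrierAt 𝒪 n p (ellipticPowerPolarisedAnchorOf E₀ n) (weilStructureServedClasses n p)` — on powers (up to isogeny) of the ONE elliptic
  curve `E₀`, for every polarisation class `θ` and every RATIONAL `E`-Weil class `w` of a CM-field structure: an `𝒪`-datum with `κ_p = a·w + c_p·θᵖ`,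
  `a ≠ 0`, sides on the `θ`-ray. With the new fact and the door: `HC_CM` for SOME `E₀` of our choice (companion proof files).
* `EllipticTensorWeilTwistedCarriers E₀` (`@[conjecture]`): the same for the road's twisted door `twistedReflexiveClass C AdmTw`, every `C`.

Both nodes are OPEN, not in print, NOT implied by the Hodge conjecture; HYPOTHESES wherever used; implied by `EllipticPowerAlgebraicCarriers 𝒪`
(the served classes are rational `(p,p)` classes on an elliptic power, hence algebraic — companion file) for every `E₀`. The honest size of the
node: for imaginary quadratic `E` the served space at `A₁ × A₁` is the PLANE `ℂ·(R ± i√δ·S)ᵖ` (`weilClassesOf_splitSquare_eq_span`); the span of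
classes of abelian subvarieties would be the whole Lefschetz space, so no span-closed cut between «Weil» and «algebraic» exists (RING2-MAP AA2.489).
References: [cite: Andre1996Motifs, Lemme 6.3.3 and proof (p. 33: V := V₀ ⊗ E, «par exemple»)] [cite: vanGeemen1994HodgeAV, 4.9 and Lemma 5.2]
[cite: MoonenZarhin1998WeilClasses, §1] [cite: Deligne1982HodgeCycles, §4 Thm. 4.8 (b) and Remark 4.10] [cite: Bloch1972Semiregularity, Remark (7.5)]
[cite: BuchweitzFlenner2003, §5 Thm. 5.1] [cite: Markman2025SecantWeil, §7.3].
-/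

noncomputable section

open CategoryTheory CategoryTheory.Limits AlgebraicGeometry Topology

namespace Summit.HodgeConjecture.HodgeConjecture.Ring2.AbelianAll

-- the cell's namespace repeats the summit name (`Summit.HodgeConjecture.HodgeConjecture…`), as in every `Ring2*` file
set_option linter.dupNamespace false

open Literature.AlgebraicGeometry Literature.AlgebraicGeometry.Motives
open Literature.AlgebraicGeometry.HodgeTheory
open Literature.AlgebraicTopology.SingularHomology
open Summit.Ventures.HSemireg (ObjClass)
open Summit.HodgeConjecture.HodgeConjecture.Ring2.SemiregularRepresentatives (AnchoredCarrierAt)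

/-- **Polarised anchors isogenous to a power of the FIXED elliptic curve `E₀`** (anchor predicate; PART AB-e's `ellipticPowerPolarisedAnchor n` with
`E₀` prescribed): `X ≅ A₀.X`, `dim A₀ = n`, `A₀` isogenous to `E₀^{N+1}`, and `θ` a polarisation class of `X`. Reducible.
[cite: Andre1996Motifs, proof of Lemme 6.3.3 (p. 33, «par exemple le H¹ d'une puissance p-ième d'une courbe elliptique»)] -/
abbrev ellipticPowerPolarisedAnchorOf (E₀ : AbelianVariety ℂ) (n : ℕ) : ∀ X : SchemeOver ℂ, complexBetti X 2 → Prop :=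
  fun X θ ↦ (∃ (A₀ : AbelianVariety ℂ) (N : ℕ), A₀.dim = n ∧ A₀.IsIsogenous (E₀.powSucc N) ∧ Nonempty (A₀.X ≅ X)) ∧
    IsPolarizationClass n X θ

/-- **Served classes: `E`-WEIL CLASSES of a CM-field structure on `X`, of Hodge type `(p,p)`** (served-class map, reducible; ignores `θ`):
`w ∈ H^{2p}(X(ℂ); ℂ)` with `IsOfHodgeType n X (2p) p p w` and EITHER `e^*w ∈ weilClassesOf A₀ ψ₀ p δ` for some `e : A₀.X ≅ X`, `δ ≥ 1`,
`ψ₀ ≫ ψ₀ = -(δ • 𝟙)`, `n = 2p` (imaginary quadratic field), OR `e^*w ∈ weilClassesField A₀ ψ₀ P (2p)` for a monic irreducible `P ∈ ℤ[T]` of degree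
`e > 2` with no real root and complex conjugation induced by some `Q ∈ ℚ[T]`, `P(ψ₀) = 0`, `n = p·e` (CM field of degree `e`; binders verbatim
those of `Andre1992_hodgeClasses_cmAbelianVariety_mem_span_pullback_weilClasses`). [cite: vanGeemen1994HodgeAV, 4.9]
[cite: MoonenZarhin1998WeilClasses, §1] [cite: Andre1996Motifs, §6.3 b) (p. 32)] -/
abbrev weilStructureServedClasses (n p : ℕ) : ∀ X : SchemeOver ℂ, complexBetti X 2 → Set (complexBetti X (2 * p)) :=
  fun X _ ↦ {w | IsOfHodgeType n X (2 * p) p p w ∧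
    ∃ (A₀ : AbelianVariety ℂ) (e : A₀.X ≅ X) (ψ₀ : A₀ ⟶ A₀),
      (∃ δ : ℕ, 0 < δ ∧ ψ₀ ≫ ψ₀ = -(δ • 𝟙 A₀) ∧ n = 2 * p ∧ complexBetti.map e.hom (2 * p) w ∈ weilClassesOf A₀ ψ₀ p δ) ∨
      (∃ (P : Polynomial ℤ) (e' : ℕ),
        P.Monic ∧ P.natDegree = e' ∧ 2 < e' ∧ Irreducible (P.map (Int.castRingHom ℚ)) ∧
          Polynomial.eval₂ (Int.castRingHom (CategoryTheory.End A₀)) (ψ₀ : CategoryTheory.End A₀) P = 0 ∧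
          n = p * e' ∧
          (∀ ρ : ℂ, Polynomial.eval₂ (Int.castRingHom ℂ) ρ P = 0 → starRingEnd ℂ ρ ≠ ρ) ∧
          (∃ Q : Polynomial ℚ, ∀ ρ : ℂ, Polynomial.eval₂ (Int.castRingHom ℂ) ρ P = 0 →
              Polynomial.eval₂ (algebraMap ℚ ℂ) ρ Q = starRingEnd ℂ ρ) ∧
          complexBetti.map e.hom (2 * p) w ∈ weilClassesField A₀ ψ₀ P (2 * p))}

/-- **CARRIERS FOR E-WEIL CLASSES AT E-TENSOR POINTS OVER THE ELLIPTIC CURVE `E₀`, for the door `𝒪` (`EllipticTensorWeilCarriers 𝒪 E₀`)**: for all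
`n`, `p` with `2 ≤ p ≤ n − 2`, on every complex scheme isomorphic to an abelian `n`-fold isogenous to a power of `E₀`, for every polarisation class
`θ` and every RATIONAL `E`-Weil class `w` of a CM-field structure on it (of type `(p,p)`): an `𝒪`-admissible datum `(I ∋ p, κ)` ON IT with
`κ_p = a·w + c_p·θᵖ`, `a ≠ 0`, `κ_q = c_q·θ^q` (`q ∈ I`, `q ≠ p`). With `andre1996_cmHodgeClasses_weilTensorPencils` and the door's local variational
Hodge statement, `HC_CM` follows as soon as this holds for ONE elliptic curve `E₀` (companion proof files). OPEN; not in print; a HYPOTHESIS wherever used.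
[cite: Bloch1972Semiregularity, Remark (7.5)] [cite: Andre1996Motifs, Lemme 6.3.3 and proof (p. 33)] [cite: Deligne1982HodgeCycles, §4 Remark 4.10] -/
@[conjecture] def EllipticTensorWeilCarriers (𝒪 : ObjClass) (E₀ : AbelianVariety ℂ) : Prop :=
  ∀ n p : ℕ, 2 ≤ p → p + 2 ≤ n → AnchoredCarrierAt 𝒪 n p (ellipticPowerPolarisedAnchorOf E₀ n) (weilStructureServedClasses n p)

/-- **TWISTED CARRIERS FOR E-WEIL CLASSES AT E-TENSOR POINTS OVER `E₀` (`EllipticTensorWeilTwistedCarriers E₀`)**: `EllipticTensorWeilCarriers` for the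
road's twisted door `twistedReflexiveClass C AdmTw` (`AdmTw := gluableSigmaAdmissible ∨ bfSingleAdmissible`), every Chern character theory `C`. OPEN;
not in print; a HYPOTHESIS wherever used. [cite: Bloch1972Semiregularity, Remark (7.5)] [cite: Markman2025SecantWeil, §7.3] [cite: BuchweitzFlenner2003, §5 Thm. 5.1] -/
@[conjecture] def EllipticTensorWeilTwistedCarriers (E₀ : AbelianVariety ℂ) : Prop :=
  ∀ C : ChernCharacterBetti, EllipticTensorWeilCarriers (twistedReflexiveClass C
    (fun n X₀ I E => Summit.Ventures.HSemireg.gluableSigmaAdmissible n X₀ I E ∨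
      Literature.AlgebraicGeometry.HodgeTheory.bfSingleAdmissible n X₀ I E)) E₀

end Summit.HodgeConjecture.HodgeConjecture.Ring2.AbelianAll

end
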